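import Summits.Ventures.Crystal3D.Theorems.StickyWulffConstantNoReconstructionGainLocalFilm
import Summits.Ventures.Crystal3D.Theorems.StickyWulffConstantNoReconstructionGainSymmetryOrbit
import HarnessLib

/-!
# Ball-by-ball certificates on the whole lattice-symmetry orbit

HONEST FRAMING. Part of the venture `Summits/Ventures/Crystal3D` (cell `crystal3d-full`), helper
`--supports` the crux `NoReconstructionGain` (stmt-Ventures-19144, route
`route-Ventures-StickyWulffConstant`), line `adhesion`; continuation of `…LocalFilm`
(`localBarlowFilm_adhesion`: few-line balls, locally basal / `R_t`-family / two-family Barlow balls).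
Here the two frames are moved by an arbitrary linear isometry `g` mapping `Λ₀` onto itself, so the
local Barlow certificates may refer to ANY ordered pair of `{111}` families (`g e₃`, `g R_t e₃`):

* `localBarlowFilm_adhesion_orbit` (**the rung**, `R = 1`, `C = 0`; registered by name).

Proof: pull the configuration back by `g⁻¹` and apply `localBarlowFilm_adhesion`; the few-lines
certificate `W` of a ball becomes `g⁻¹ W`.

WHAT THIS IS NOT: films below the cut; balls with non-Barlow `≥ 7`-shells on more than six lines; rung
F-C1 not moved.
-/

noncomputable section

namespace Summit.Ventures.Crystal3D.Theorems

open Summit.Ventures.Crystal3D Finset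
open Literature.MathematicalPhysics.StatisticalMechanics (barlowPos fccStacking barlowOffset constHagg
  barlowPos_apply_two orderedContacts contactDeficiency)
open scoped InnerProductSpace

/-- **The atom from ball-by-ball certificates in the frames `g e₃`, `g R_t e₃`** (`R = 1`, `C = 0`;
registered by name on stmt-Ventures-19144). -/
theorem localBarlowFilm_adhesion_orbit :
    ∃ R C : ℝ, 1 ≤ R ∧ ∀ ν : EuclideanSpace ℝ (Fin 3), ‖ν‖ = 1 → ∀ ρ : ℝ, R ≤ ρ →
      ∀ X P : Finset (EuclideanSpace ℝ (Fin 3)),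
      (∀ p ∈ X, ∀ q ∈ X, p ≠ q → 1 ≤ dist p q) → P ⊆ X →
      (∀ p, p ∈ P ↔ (p ∈ fccStacking 1 (Real.sqrt (2 / 3)) ∧ -(2 * R) ≤ ⟪p, ν⟫_ℝ ∧
        ⟪p, ν⟫_ℝ ≤ -R ∧ ‖p‖ ^ 2 - ⟪p, ν⟫_ℝ ^ 2 ≤ ρ ^ 2)) →
      ∀ g : EuclideanSpace ℝ (Fin 3) ≃ₗᵢ[ℝ] EuclideanSpace ℝ (Fin 3),
      (∀ p ∈ fccStacking 1 (Real.sqrt (2 / 3)), g p ∈ fccStacking 1 (Real.sqrt (2 / 3))) →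
      (∀ p ∈ fccStacking 1 (Real.sqrt (2 / 3)), g.symm p ∈ fccStacking 1 (Real.sqrt (2 / 3))) →
      (∀ q ∈ X \ P, -R < ⟪q, ν⟫_ℝ) →
      (∀ q ∈ X \ P,
        (∃ W : Finset (EuclideanSpace ℝ (Fin 3)), W.card ≤ 6 ∧
            ∀ x ∈ X, dist q x = 1 → ∃ w ∈ W, x = q + w ∨ x = q - w) ∨
        (1 / 3 < ⟪ν, g (EuclideanSpace.single (2 : Fin 3) (1 : ℝ))⟫_ℝ ^ 2 ∧ ∀ x ∈ X, dist q x = 1 →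
            x - q ∈ fccStacking 1 (Real.sqrt (2 / 3)) ∨
            x - q - g (barlowOffset 1) ∈ fccStacking 1 (Real.sqrt (2 / 3)) ∨
            x - q + g (barlowOffset 1) ∈ fccStacking 1 (Real.sqrt (2 / 3))) ∨
        (1 / 3 < ⟪ν, g ((2 * Real.sqrt (2 / 3)) • barlowPos 1 (Real.sqrt (2 / 3)) constHagg 1 0 0 -
            EuclideanSpace.single (2 : Fin 3) (1 : ℝ))⟫_ℝ ^ 2 ∧
          ∀ x ∈ X, dist q x = 1 →
            x - q ∈ fccStacking 1 (Real.sqrt (2 / 3)) ∨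
            x - q - g ((2 / 3 : ℝ) • barlowPos 1 (Real.sqrt (2 / 3)) constHagg 1 0 0 - barlowOffset 1) ∈
              fccStacking 1 (Real.sqrt (2 / 3)) ∨
            x - q + g ((2 / 3 : ℝ) • barlowPos 1 (Real.sqrt (2 / 3)) constHagg 1 0 0 - barlowOffset 1) ∈
              fccStacking 1 (Real.sqrt (2 / 3))) ∨
        (1 / 3 < ⟪ν, g (EuclideanSpace.single (2 : Fin 3) (1 : ℝ))⟫_ℝ ^ 2 ∧
          1 / 3 < ⟪ν, g ((2 * Real.sqrt (2 / 3)) • barlowPos 1 (Real.sqrt (2 / 3)) constHagg 1 0 0 -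
            EuclideanSpace.single (2 : Fin 3) (1 : ℝ))⟫_ℝ ^ 2 ∧
          ∀ x ∈ X, dist q x = 1 →
            x - q ∈ fccStacking 1 (Real.sqrt (2 / 3)) ∨
            x - q - g (barlowOffset 1) ∈ fccStacking 1 (Real.sqrt (2 / 3)) ∨
            x - q + g (barlowOffset 1) ∈ fccStacking 1 (Real.sqrt (2 / 3)) ∨
            x - q - g ((2 / 3 : ℝ) • barlowPos 1 (Real.sqrt (2 / 3)) constHagg 1 0 0 - barlowOffset 1) ∈
              fccStacking 1 (Real.sqrt (2 / 3)) ∨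
            x - q + g ((2 / 3 : ℝ) • barlowPos 1 (Real.sqrt (2 / 3)) constHagg 1 0 0 - barlowOffset 1) ∈
              fccStacking 1 (Real.sqrt (2 / 3)))) →
      ((((P ×ˢ (X \ P)).filter fun pq => dist pq.1 pq.2 = 1).card : ℕ) : ℝ) ≤
        contactDeficiency (X \ P) + C * ρ := by
  classical
  obtain ⟨R, C, hR, h⟩ := localBarlowFilm_adhesion
  refine ⟨R, C, hR, fun ν hν ρ hρ X P hX hPX hP g hg hg' habove hcert => ?_⟩
  -- pull back by `g⁻¹`
  have hgi : Isometry (g.symm : EuclideanSpace ℝ (Fin 3) → EuclideanSpace ℝ (Fin 3)) :=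
    g.symm.isometry
  have hinj : Function.Injective (g.symm : EuclideanSpace ℝ (Fin 3) → EuclideanSpace ℝ (Fin 3)) :=
    g.symm.injective
  set X' := X.image g.symm with hX'
  set P' := P.image g.symm with hP'def
  set ν' := g.symm ν with hν'
  have hsd : X' \ P' = (X \ P).image g.symm := by
    rw [hX', hP'def, image_sdiff_of_injOn hinj.injOn hPX]
  have hXp : ∀ p ∈ X', ∀ q ∈ X', p ≠ q → 1 ≤ dist p q := by
    intro p hp q hq hpq
    obtain ⟨p₀, hp₀, rfl⟩ := mem_image.1 hp
    obtain ⟨q₀, hq₀, rfl⟩ := mem_image.1 hq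
    rw [hgi.dist_eq]
    exact hX p₀ hp₀ q₀ hq₀ fun e => hpq (by rw [e])
  have hPXp : P' ⊆ X' := image_subset_image hPX
  have hinn : ∀ p, ⟪g.symm p, ν'⟫_ℝ = ⟪p, ν⟫_ℝ := fun p => by
    rw [hν', LinearIsometryEquiv.inner_map_map]
  have hνn : ‖ν'‖ = 1 := by rw [hν', LinearIsometryEquiv.norm_map, hν]
  have hPp : ∀ p, p ∈ P' ↔ (p ∈ fccStacking 1 (Real.sqrt (2 / 3)) ∧ -(2 * R) ≤ ⟪p, ν'⟫_ℝ ∧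
      ⟪p, ν'⟫_ℝ ≤ -R ∧ ‖p‖ ^ 2 - ⟪p, ν'⟫_ℝ ^ 2 ≤ ρ ^ 2) := by
    intro p
    rw [hP'def, mem_image]
    constructor
    · rintro ⟨p₀, hp₀, rfl⟩
      obtain ⟨hΛ, h1, h2, h3⟩ := (hP p₀).1 hp₀
      refine ⟨hg' p₀ hΛ, ?_, ?_, ?_⟩
      · rw [hinn]; exact h1
      · rw [hinn]; exact h2
      · rw [hinn, LinearIsometryEquiv.norm_map]; exact h3
    · rintro ⟨hΛ, h1, h2, h3⟩
      have hi : ⟪g p, ν⟫_ℝ = ⟪p, ν'⟫_ℝ := by rw [← hinn (g p), LinearIsometryEquiv.symm_apply_apply]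
      refine ⟨g p, (hP (g p)).2 ⟨hg p hΛ, ?_, ?_, ?_⟩, g.symm_apply_apply p⟩
      · rw [hi]; exact h1
      · rw [hi]; exact h2
      · rw [hi, LinearIsometryEquiv.norm_map]; exact h3
  -- the transported cone quantities
  have hpull : ∀ z : EuclideanSpace ℝ (Fin 3), ⟪ν', z⟫_ℝ = ⟪ν, g z⟫_ℝ := fun z => by
    rw [hν', ← g.inner_map_map, LinearIsometryEquiv.apply_symm_apply]
  have hin3 : ∀ z : EuclideanSpace ℝ (Fin 3), ⟪z, EuclideanSpace.single (2 : Fin 3) (1 : ℝ)⟫_ℝ = z 2 :=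
    fun z => by simp [EuclideanSpace.inner_single_right]
  have e3 : ν' 2 = ⟪ν, g (EuclideanSpace.single (2 : Fin 3) (1 : ℝ))⟫_ℝ := by rw [← hin3, hpull]
  have eb : 2 * ⟪ν', barlowPos 1 (Real.sqrt (2 / 3)) constHagg 1 0 0⟫_ℝ * Real.sqrt (2 / 3) - ν' 2 =
      ⟪ν, g ((2 * Real.sqrt (2 / 3)) • barlowPos 1 (Real.sqrt (2 / 3)) constHagg 1 0 0 -
        EuclideanSpace.single (2 : Fin 3) (1 : ℝ))⟫_ℝ := by
    rw [← hpull, inner_sub_right, inner_smul_right, hin3]; ring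
  have habove' : ∀ q ∈ X' \ P', -R < ⟪q, ν'⟫_ℝ := by
    intro q hq
    rw [hsd] at hq
    obtain ⟨q₀, hq₀, rfl⟩ := mem_image.1 hq
    rw [hinn]; exact habove q₀ hq₀
  -- partners of `g⁻¹ q₀` in `X'` are the `g⁻¹ x`, `x` a partner of `q₀`
  have hpartner : ∀ q₀ y : EuclideanSpace ℝ (Fin 3), y ∈ X' → dist (g.symm q₀) y = 1 →
      ∃ x ∈ X, dist q₀ x = 1 ∧ y = g.symm x := by
    intro q₀ y hy hd
    obtain ⟨x, hx, rfl⟩ := mem_image.1 hy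
    exact ⟨x, hx, by rwa [hgi.dist_eq] at hd, rfl⟩
  have hrel : ∀ q₀ x z : EuclideanSpace ℝ (Fin 3),
      (x - q₀ - g z ∈ fccStacking 1 (Real.sqrt (2 / 3)) →
        g.symm x - g.symm q₀ - z ∈ fccStacking 1 (Real.sqrt (2 / 3))) ∧
      (x - q₀ + g z ∈ fccStacking 1 (Real.sqrt (2 / 3)) →
        g.symm x - g.symm q₀ + z ∈ fccStacking 1 (Real.sqrt (2 / 3))) := by
    intro q₀ x z
    constructor
    · intro hm
      have := hg' _ hm
      rwa [map_sub, map_sub, LinearIsometryEquiv.symm_apply_apply] at this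
    · intro hm
      have := hg' _ hm
      rwa [map_add, map_sub, LinearIsometryEquiv.symm_apply_apply] at this
  have hrel0 : ∀ q₀ x : EuclideanSpace ℝ (Fin 3), x - q₀ ∈ fccStacking 1 (Real.sqrt (2 / 3)) →
      g.symm x - g.symm q₀ ∈ fccStacking 1 (Real.sqrt (2 / 3)) := by
    intro q₀ x hm
    have := hg' _ hm
    rwa [map_sub] at this
  have hcert' : ∀ q ∈ X' \ P',
      (∃ W : Finset (EuclideanSpace ℝ (Fin 3)), W.card ≤ 6 ∧
          ∀ x ∈ X', dist q x = 1 → ∃ w ∈ W, x = q + w ∨ x = q - w) ∨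
      (1 / 3 < ν' 2 ^ 2 ∧ ∀ x ∈ X', dist q x = 1 →
          x - q ∈ fccStacking 1 (Real.sqrt (2 / 3)) ∨
          x - q - barlowOffset 1 ∈ fccStacking 1 (Real.sqrt (2 / 3)) ∨
          x - q + barlowOffset 1 ∈ fccStacking 1 (Real.sqrt (2 / 3))) ∨
      (1 / 3 < (2 * ⟪ν', barlowPos 1 (Real.sqrt (2 / 3)) constHagg 1 0 0⟫_ℝ * Real.sqrt (2 / 3) - ν' 2) ^ 2 ∧
        ∀ x ∈ X', dist q x = 1 →
          x - q ∈ fccStacking 1 (Real.sqrt (2 / 3)) ∨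
          x - q - ((2 / 3 : ℝ) • barlowPos 1 (Real.sqrt (2 / 3)) constHagg 1 0 0 - barlowOffset 1) ∈
            fccStacking 1 (Real.sqrt (2 / 3)) ∨
          x - q + ((2 / 3 : ℝ) • barlowPos 1 (Real.sqrt (2 / 3)) constHagg 1 0 0 - barlowOffset 1) ∈
            fccStacking 1 (Real.sqrt (2 / 3))) ∨
      (1 / 3 < ν' 2 ^ 2 ∧
        1 / 3 < (2 * ⟪ν', barlowPos 1 (Real.sqrt (2 / 3)) constHagg 1 0 0⟫_ℝ * Real.sqrt (2 / 3) - ν' 2) ^ 2 ∧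
        ∀ x ∈ X', dist q x = 1 →
          x - q ∈ fccStacking 1 (Real.sqrt (2 / 3)) ∨
          x - q - barlowOffset 1 ∈ fccStacking 1 (Real.sqrt (2 / 3)) ∨
          x - q + barlowOffset 1 ∈ fccStacking 1 (Real.sqrt (2 / 3)) ∨
          x - q - ((2 / 3 : ℝ) • barlowPos 1 (Real.sqrt (2 / 3)) constHagg 1 0 0 - barlowOffset 1) ∈
            fccStacking 1 (Real.sqrt (2 / 3)) ∨
          x - q + ((2 / 3 : ℝ) • barlowPos 1 (Real.sqrt (2 / 3)) constHagg 1 0 0 - barlowOffset 1) ∈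
            fccStacking 1 (Real.sqrt (2 / 3))) := by
    intro q hq
    rw [hsd] at hq
    obtain ⟨q₀, hq₀, rfl⟩ := mem_image.1 hq
    rcases hcert q₀ hq₀ with ⟨W, hWc, hW⟩ | ⟨h3, hl⟩ | ⟨hb, hl⟩ | ⟨h3, hb, hl⟩
    · refine Or.inl ⟨W.image g.symm, card_image_le.trans hWc, fun y hy hd => ?_⟩
      obtain ⟨x, hx, hdx, rfl⟩ := hpartner q₀ y hy hd
      obtain ⟨w, hw, hxw⟩ := hW x hx hdx
      refine ⟨g.symm w, mem_image_of_mem _ hw, ?_⟩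
      rcases hxw with e | e
      · left; rw [e, map_add]
      · right; rw [e, map_sub]
    · refine Or.inr (Or.inl ⟨by rw [e3]; exact h3, fun y hy hd => ?_⟩)
      obtain ⟨x, hx, hdx, rfl⟩ := hpartner q₀ y hy hd
      rcases hl x hx hdx with hm | hm | hm
      exacts [Or.inl (hrel0 q₀ x hm), Or.inr (Or.inl ((hrel q₀ x _).1 hm)),
        Or.inr (Or.inr ((hrel q₀ x _).2 hm))]
    · refine Or.inr (Or.inr (Or.inl ⟨by rw [eb]; exact hb, fun y hy hd => ?_⟩))
      obtain ⟨x, hx, hdx, rfl⟩ := hpartner q₀ y hy hd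
      rcases hl x hx hdx with hm | hm | hm
      exacts [Or.inl (hrel0 q₀ x hm), Or.inr (Or.inl ((hrel q₀ x _).1 hm)),
        Or.inr (Or.inr ((hrel q₀ x _).2 hm))]
    · refine Or.inr (Or.inr (Or.inr ⟨by rw [e3]; exact h3, by rw [eb]; exact hb, fun y hy hd => ?_⟩))
      obtain ⟨x, hx, hdx, rfl⟩ := hpartner q₀ y hy hd
      rcases hl x hx hdx with hm | hm | hm | hm | hm
      exacts [Or.inl (hrel0 q₀ x hm), Or.inr (Or.inl ((hrel q₀ x _).1 hm)),
        Or.inr (Or.inr (Or.inl ((hrel q₀ x _).2 hm))),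
        Or.inr (Or.inr (Or.inr (Or.inl ((hrel q₀ x _).1 hm)))),
        Or.inr (Or.inr (Or.inr (Or.inr ((hrel q₀ x _).2 hm))))]
  have hmain := h ν' hνn ρ hρ X' P' hXp hPXp hPp habove' hcert'
  rw [hsd, hP'def, card_cross_image_of_isometry hgi, contactDeficiency_image_of_isometry hgi]
    at hmain
  exact hmain

end Summit.Ventures.Crystal3D.Theorems

end
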